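import Summits.Ventures.CertifiedManyBodySolver.Downfold.EmeryFermiVelocityScale
import HarnessLib

/-!
# The one-band scale at the Fermi surface, II: rational interval images of the contour quantities (the inclusion
# property, composed) and the certified `s`-range `[sigmaLo, sigmaHi]` of a zone contour over a parameter box

Venture CertifiedManyBodySolver, cell `pub/hubbard-downfold` (stage S1), seat hubbard-downfold-mod-4 (technique B); namespace
`Summit.Ventures.CertifiedManyBodySolver.Downfold.Emery`. Everything here is PROVED. WHAT THIS IS NOT: a statement about any
material; no number lives here. Companion of `EmeryFermiVelocityScale` (contour geometry, affine energy denominator) and of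
`EmeryFermiVelocityScaleCheck` (the kernel-decidable box rule `scaleCheck` built from the images below).

* §3.1 membership plumbing for cast rational intervals (`ihull`, `mem_ratCast_add/sub/mul/sq`, `mem_idivPos`, `mem_iscale`) on
  the tree's `NonemptyInterval.ratCast` / `mooreMul` / `divPos` (Moore 1966, inclusion property);
* §3.2 interval images `icA, ifsD, ifsN, ifsT, idcA, idfsD, idfsN, idcharA, idcharB` of the contour quantities of
  `EmeryFermiSurfaceShape(Box)` with the composed inclusion `mem_images`; the certified `s`-range ends `sigmaLo` (conservative
  AM–GM test, `sigmaLo_le_sum`) and `sigmaHi` (two zone faces, `sum_le_sigmaHi`); the images `idchar`, `iscaleT` of the energy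
  denominator and of the velocity-matched scale.

Sources: [HybertsenSchluterChristensen1989, Eq. (1)]; [AndersenEtAl1995, §6]; interval arithmetic [folklore] (Moore 1966, Ch. 2–3).
-/

noncomputable section

namespace Summit.Ventures.CertifiedManyBodySolver.Downfold.Emery

open Real Set NonemptyInterval

/-! ## §3 The box rule: rational interval arithmetic decided by the kernel -/

/-! ### §3.1 Membership plumbing for cast rational intervals -/

/-- The rational interval spanned by two rationals (in either order). [folklore] -/
def ihull (a b : ℚ) : NonemptyInterval ℚ := ⟨(min a b, max a b), min_le_max⟩

/-- A real in `[a, b]` lies in the cast of `ihull a b`. [folklore] -/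
theorem mem_ihull {a b : ℚ} {x : ℝ} (h : x ∈ Set.Icc (a : ℝ) b) : x ∈ (ihull a b).ratCast ℝ := by
  rw [mem_ratCast_iff]
  refine ⟨?_, ?_⟩
  · have : ((min a b : ℚ) : ℝ) ≤ (a : ℝ) := by exact_mod_cast min_le_left a b
    exact this.trans h.1
  · have : (b : ℝ) ≤ ((max a b : ℚ) : ℝ) := by exact_mod_cast le_max_right a b
    exact h.2.trans this

/-- Sums are enclosed by the interval sum. [folklore] -/
theorem mem_ratCast_add {I J : NonemptyInterval ℚ} {x y : ℝ} (hx : x ∈ I.ratCast ℝ) (hy : y ∈ J.ratCast ℝ) :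
    x + y ∈ (I + J).ratCast ℝ := by
  rw [mem_ratCast_iff] at hx hy ⊢
  simp only [NonemptyInterval.fst_add, NonemptyInterval.snd_add, Rat.cast_add]
  exact ⟨add_le_add hx.1 hy.1, add_le_add hx.2 hy.2⟩

/-- Differences are enclosed by the interval difference. [folklore] -/
theorem mem_ratCast_sub {I J : NonemptyInterval ℚ} {x y : ℝ} (hx : x ∈ I.ratCast ℝ) (hy : y ∈ J.ratCast ℝ) :
    x - y ∈ (I - J).ratCast ℝ := by
  rw [mem_ratCast_iff] at hx hy ⊢
  simp only [NonemptyInterval.fst_sub, NonemptyInterval.snd_sub, Rat.cast_sub]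
  exact ⟨by linarith [hx.1, hy.2], by linarith [hx.2, hy.1]⟩

/-- Products are enclosed by the Moore product. [folklore] -/
theorem mem_ratCast_mul {I J : NonemptyInterval ℚ} {x y : ℝ} (hx : x ∈ I.ratCast ℝ) (hy : y ∈ J.ratCast ℝ) :
    x * y ∈ (I.mooreMul J).ratCast ℝ := by
  rw [ratCast_mooreMul]
  exact mul_mem_mooreMul hx hy

/-- Squares are enclosed by the Moore square. [folklore] -/
theorem mem_ratCast_sq {I : NonemptyInterval ℚ} {x : ℝ} (hx : x ∈ I.ratCast ℝ) :
    x ^ 2 ∈ (I.moorePow 2).ratCast ℝ := by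
  rw [ratCast_moorePow]
  exact pow_mem_moorePow hx 2

/-- A rational constant lies in its point interval. [folklore] -/
theorem mem_ratCast_pure (q : ℚ) : ((q : ℝ)) ∈ (NonemptyInterval.pure q).ratCast ℝ := by
  rw [ratCast_pure]
  exact NonemptyInterval.mem_pure_self _

/-- A real equal to the cast of `q` lies in the point interval `[q, q]`. [folklore] -/
theorem mem_pure_of_cast_eq {q : ℚ} {r : ℝ} (h : (q : ℝ) = r) : r ∈ (NonemptyInterval.pure q).ratCast ℝ := by
  rw [← h]
  exact mem_ratCast_pure q

/-! ### §3.2 Interval images of the contour quantities -/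

/-- Interval image of `cA = ε(Δ + ε)²`. [folklore] -/
def icA (IΔ Ie : NonemptyInterval ℚ) : NonemptyInterval ℚ := Ie.mooreMul ((IΔ + Ie).moorePow 2)

/-- Interval image of `fsD = (Δ + ε)(t_pd² − t_pp′ε)`. [folklore] -/
def ifsD (IΔ Ia Ic Ie : NonemptyInterval ℚ) : NonemptyInterval ℚ := (IΔ + Ie).mooreMul (Ia.moorePow 2 - Ic.mooreMul Ie)

/-- Interval image of `fsN = 2t_pd²(t_pp′ + t_pp) + ε(t_pp² − t_pp′²)`. [folklore] -/
def ifsN (Ia Ib Ic Ie : NonemptyInterval ℚ) : NonemptyInterval ℚ :=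
  ((NonemptyInterval.pure 2).mooreMul (Ia.moorePow 2)).mooreMul (Ic + Ib) + Ie.mooreMul (Ib.moorePow 2 - Ic.moorePow 2)

/-- Interval image of `fsT = fsD + 2fsN`. [folklore] -/
def ifsT (IΔ Ia Ib Ic Ie : NonemptyInterval ℚ) : NonemptyInterval ℚ :=
  ifsD IΔ Ia Ic Ie + (NonemptyInterval.pure 2).mooreMul (ifsN Ia Ib Ic Ie)

/-- Interval image of `cA′ = (Δ + ε)(Δ + 3ε)`. [folklore] -/
def idcA (IΔ Ie : NonemptyInterval ℚ) : NonemptyInterval ℚ := (IΔ + Ie).mooreMul (IΔ + (NonemptyInterval.pure 3).mooreMul Ie)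

/-- Interval image of `fsD′ = t_pd² − t_pp′(Δ + 2ε)`. [folklore] -/
def idfsD (IΔ Ia Ic Ie : NonemptyInterval ℚ) : NonemptyInterval ℚ :=
  Ia.moorePow 2 - Ic.mooreMul (IΔ + (NonemptyInterval.pure 2).mooreMul Ie)

/-- Interval image of `fsN′ = t_pp² − t_pp′²`. [folklore] -/
def idfsN (Ib Ic : NonemptyInterval ℚ) : NonemptyInterval ℚ := Ib.moorePow 2 - Ic.moorePow 2

/-- TOTAL quotient by a positive interval: `divPos` when `0 < T.fst`, else (never used) the numerator itself — so that
the checker below is a plain conjunction of decidable tests. [folklore] -/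
def idivPos (I T : NonemptyInterval ℚ) : NonemptyInterval ℚ :=
  if h : 0 < T.fst then NonemptyInterval.divPos I T h else I

/-- Inclusion property of `idivPos` (under `0 < T.fst`). [folklore] -/
theorem mem_idivPos {I T : NonemptyInterval ℚ} (h : 0 < T.fst) {x s : ℝ} (hx : x ∈ I.ratCast ℝ)
    (hs : s ∈ T.ratCast ℝ) : x / s ∈ (idivPos I T).ratCast ℝ := by
  rw [idivPos, dif_pos h]
  exact div_mem_divPos h hx hs

/-- Scalar multiple `q·I` as a Moore product with the point interval `[q, q]`. [folklore] -/
def iscale (q : ℚ) (I : NonemptyInterval ℚ) : NonemptyInterval ℚ := (NonemptyInterval.pure q).mooreMul I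

/-- Inclusion property of `iscale`: `(q : ℝ)·x ∈ q·I`. [folklore] -/
theorem mem_iscale (q : ℚ) {I : NonemptyInterval ℚ} {x : ℝ} (hx : x ∈ I.ratCast ℝ) :
    (q : ℝ) * x ∈ (iscale q I).ratCast ℝ := by
  unfold iscale
  exact mem_ratCast_mul (mem_ratCast_pure q) hx

/-- Interval image of `dcharA = cA′ − fsN′·cA/fsN`. [folklore] -/
def idcharA (IΔ Ia Ib Ic Ie : NonemptyInterval ℚ) : NonemptyInterval ℚ :=
  idcA IΔ Ie - idivPos ((idfsN Ib Ic).mooreMul (icA IΔ Ie)) (ifsN Ia Ib Ic Ie)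

/-- Interval image of `dcharB = (−4)·fsD′ + ((4·fsD)·fsN′)/fsN` (parse-matched). [folklore] -/
def idcharB (IΔ Ia Ib Ic Ie : NonemptyInterval ℚ) : NonemptyInterval ℚ :=
  iscale (-4) (idfsD IΔ Ia Ic Ie) + idivPos ((iscale 4 (ifsD IΔ Ia Ic Ie)).mooreMul (idfsN Ib Ic)) (ifsN Ia Ib Ic Ie)

/-- Certified LOWER value of `s = x + y` on the zone contour over the box: the candidate `σ0` if the conservative
AM–GM test `(sup fsD + 2·sup fsN·σ0)² ≤ inf fsN·inf cA + (inf fsD)²` passes (with `σ0, inf cA ≥ 0`), else `0`.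
[folklore] -/
def sigmaLo (IΔ Ia Ib Ic Ie : NonemptyInterval ℚ) (σ0 : ℚ) : ℚ :=
  if 0 ≤ σ0 ∧ 0 ≤ (icA IΔ Ie).fst ∧
      ((ifsD IΔ Ia Ic Ie).snd + 2 * (ifsN Ia Ib Ic Ie).snd * σ0) ^ 2 ≤
        (ifsN Ia Ib Ic Ie).fst * (icA IΔ Ie).fst + (ifsD IΔ Ia Ic Ie).fst ^ 2
  then σ0 else 0

/-- `sigmaLo ≥ 0`. [folklore] -/
theorem sigmaLo_nonneg (IΔ Ia Ib Ic Ie : NonemptyInterval ℚ) (σ0 : ℚ) : 0 ≤ sigmaLo IΔ Ia Ib Ic Ie σ0 := by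
  unfold sigmaLo
  split_ifs with h
  · exact h.1
  · exact le_rfl

/-- Certified UPPER value of `s = x + y` on the zone contour over the box: the smaller of the two face bounds
`sup cA/(4fsD)` and `1 + sup (cA − 4fsD)/(16fsN + 4fsD)`. [folklore] -/
def sigmaHi (IΔ Ia Ib Ic Ie : NonemptyInterval ℚ) : ℚ :=
  min (idivPos (icA IΔ Ie) (iscale 4 (ifsD IΔ Ia Ic Ie))).snd
    (1 + (idivPos (icA IΔ Ie - iscale 4 (ifsD IΔ Ia Ic Ie))
      (iscale 16 (ifsN Ia Ib Ic Ie) + iscale 4 (ifsD IΔ Ia Ic Ie))).snd)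

/-- Interval image of the energy denominator `∂_ε charCubic = dcharA + dcharB·s` on the zone contour. [folklore] -/
def idchar (IΔ Ia Ib Ic Ie : NonemptyInterval ℚ) (σ0 : ℚ) : NonemptyInterval ℚ :=
  idcharA IΔ Ia Ib Ic Ie + (idcharB IΔ Ia Ib Ic Ie).mooreMul (ihull (sigmaLo IΔ Ia Ib Ic Ie σ0) (sigmaHi IΔ Ia Ib Ic Ie))

/-- Interval image of the velocity-matched scale `scaleT = fsT/∂_ε charCubic`. [folklore] -/
def iscaleT (IΔ Ia Ib Ic Ie : NonemptyInterval ℚ) (σ0 : ℚ) : NonemptyInterval ℚ :=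
  idivPos (ifsT IΔ Ia Ib Ic Ie) (idchar IΔ Ia Ib Ic Ie σ0)

/-! ### §3.3 The checker and its soundness -/

/-- MEMBERSHIP LEMMA: every contour quantity lies in its interval image (the inclusion property, composed).
[folklore] -/
theorem mem_images {Δ₁ Δ₂ a₁ a₂ b₁ b₂ c₁ c₂ e₁ e₂ : ℚ} {Δ tpd tpp c ε : ℝ} (hΔ : Δ ∈ Set.Icc (Δ₁ : ℝ) Δ₂)
    (ha : tpd ∈ Set.Icc (a₁ : ℝ) a₂) (hb : tpp ∈ Set.Icc (b₁ : ℝ) b₂) (hc : c ∈ Set.Icc (c₁ : ℝ) c₂)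
    (he : ε ∈ Set.Icc (e₁ : ℝ) e₂) :
    cA Δ ε ∈ (icA (ihull Δ₁ Δ₂) (ihull e₁ e₂)).ratCast ℝ ∧
    fsD Δ tpd c ε ∈ (ifsD (ihull Δ₁ Δ₂) (ihull a₁ a₂) (ihull c₁ c₂) (ihull e₁ e₂)).ratCast ℝ ∧
    fsN tpd tpp c ε ∈ (ifsN (ihull a₁ a₂) (ihull b₁ b₂) (ihull c₁ c₂) (ihull e₁ e₂)).ratCast ℝ ∧
    fsT Δ tpd tpp c ε ∈ (ifsT (ihull Δ₁ Δ₂) (ihull a₁ a₂) (ihull b₁ b₂) (ihull c₁ c₂) (ihull e₁ e₂)).ratCast ℝ ∧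
    dcA Δ ε ∈ (idcA (ihull Δ₁ Δ₂) (ihull e₁ e₂)).ratCast ℝ ∧
    dfsD Δ tpd c ε ∈ (idfsD (ihull Δ₁ Δ₂) (ihull a₁ a₂) (ihull c₁ c₂) (ihull e₁ e₂)).ratCast ℝ ∧
    dfsN tpp c ∈ (idfsN (ihull b₁ b₂) (ihull c₁ c₂)).ratCast ℝ := by
  have mΔ := mem_ihull hΔ
  have ma := mem_ihull ha
  have mb := mem_ihull hb
  have mc := mem_ihull hc
  have me := mem_ihull he
  have mΔe := mem_ratCast_add mΔ me
  have m2 : (2 : ℝ) ∈ (NonemptyInterval.pure (2 : ℚ)).ratCast ℝ := mem_pure_of_cast_eq (by norm_num)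
  have m3 : (3 : ℝ) ∈ (NonemptyInterval.pure (3 : ℚ)).ratCast ℝ := mem_pure_of_cast_eq (by norm_num)
  have mfsD : fsD Δ tpd c ε ∈ (ifsD (ihull Δ₁ Δ₂) (ihull a₁ a₂) (ihull c₁ c₂) (ihull e₁ e₂)).ratCast ℝ := by
    unfold fsD ifsD
    exact mem_ratCast_mul mΔe (mem_ratCast_sub (mem_ratCast_sq ma) (mem_ratCast_mul mc me))
  have mfsN : fsN tpd tpp c ε ∈ (ifsN (ihull a₁ a₂) (ihull b₁ b₂) (ihull c₁ c₂) (ihull e₁ e₂)).ratCast ℝ := by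
    unfold fsN ifsN
    exact mem_ratCast_add (mem_ratCast_mul (mem_ratCast_mul m2 (mem_ratCast_sq ma)) (mem_ratCast_add mc mb))
      (mem_ratCast_mul me (mem_ratCast_sub (mem_ratCast_sq mb) (mem_ratCast_sq mc)))
  refine ⟨?_, mfsD, mfsN, ?_, ?_, ?_, ?_⟩
  · unfold cA icA
    exact mem_ratCast_mul me (mem_ratCast_sq mΔe)
  · unfold fsT ifsT
    exact mem_ratCast_add mfsD (mem_ratCast_mul m2 mfsN)
  · unfold dcA idcA
    exact mem_ratCast_mul mΔe (mem_ratCast_add mΔ (mem_ratCast_mul m3 me))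
  · unfold dfsD idfsD
    exact mem_ratCast_sub (mem_ratCast_sq ma) (mem_ratCast_mul mc (mem_ratCast_add mΔ (mem_ratCast_mul m2 me)))
  · unfold dfsN idfsN
    exact mem_ratCast_sub (mem_ratCast_sq mb) (mem_ratCast_sq mc)


/-- Pointwise validity of the certified lower `s`-value: under the conservative AM–GM test of `sigmaLo`,
`sigmaLo ≤ x + y` at every zone contour point. [folklore] -/
theorem sigmaLo_le_sum {IΔ Ia Ib Ic Ie : NonemptyInterval ℚ} {σ0 : ℚ} {Δ tpd tpp c x y ε : ℝ}
    (mcA : cA Δ ε ∈ (icA IΔ Ie).ratCast ℝ) (mD : fsD Δ tpd c ε ∈ (ifsD IΔ Ia Ic Ie).ratCast ℝ)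
    (mN : fsN tpd tpp c ε ∈ (ifsN Ia Ib Ic Ie).ratCast ℝ) (hN : 0 < fsN tpd tpp c ε) (hD : 0 < fsD Δ tpd c ε)
    (hNq : 0 < (ifsN Ia Ib Ic Ie).fst) (hDq : 0 < (ifsD IΔ Ia Ic Ie).fst)
    (hx : 0 ≤ x) (hy : 0 ≤ y) (hP : charCubic Δ tpd tpp c x y ε = 0) :
    ((sigmaLo IΔ Ia Ib Ic Ie σ0 : ℚ) : ℝ) ≤ x + y := by
  unfold sigmaLo
  split_ifs with h
  · obtain ⟨hσ0, hcA0, hchk⟩ := h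
    rw [mem_ratCast_iff] at mcA mD mN
    apply le_sum_of_contour hN hD hx hy hP
    -- (fsD + 2 fsN σ0)^2 ≤ fsK pointwise from the conservative rational test
    have hσ0' : (0 : ℝ) ≤ (σ0 : ℝ) := by exact_mod_cast hσ0
    have hup : fsD Δ tpd c ε + 2 * fsN tpd tpp c ε * (σ0 : ℝ) ≤
        ((ifsD IΔ Ia Ic Ie).snd : ℝ) + 2 * ((ifsN Ia Ib Ic Ie).snd : ℝ) * (σ0 : ℝ) := by
      nlinarith [mD.2, mN.2]
    have hlow : 0 ≤ fsD Δ tpd c ε + 2 * fsN tpd tpp c ε * (σ0 : ℝ) := by positivity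
    have hsq : (fsD Δ tpd c ε + 2 * fsN tpd tpp c ε * (σ0 : ℝ)) ^ 2 ≤
        (((ifsD IΔ Ia Ic Ie).snd : ℝ) + 2 * ((ifsN Ia Ib Ic Ie).snd : ℝ) * (σ0 : ℝ)) ^ 2 :=
      pow_le_pow_left₀ hlow hup 2
    have hchk' : ((((ifsD IΔ Ia Ic Ie).snd + 2 * (ifsN Ia Ib Ic Ie).snd * σ0) ^ 2 : ℚ) : ℝ) ≤
        (((ifsN Ia Ib Ic Ie).fst * (icA IΔ Ie).fst + (ifsD IΔ Ia Ic Ie).fst ^ 2 : ℚ) : ℝ) := by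
      exact_mod_cast hchk
    push_cast at hchk'
    have hNq' : (0 : ℝ) < ((ifsN Ia Ib Ic Ie).fst : ℝ) := by exact_mod_cast hNq
    have hDq' : (0 : ℝ) < ((ifsD IΔ Ia Ic Ie).fst : ℝ) := by exact_mod_cast hDq
    have hcA0' : (0 : ℝ) ≤ ((icA IΔ Ie).fst : ℝ) := by exact_mod_cast hcA0
    have hK : ((ifsN Ia Ib Ic Ie).fst : ℝ) * ((icA IΔ Ie).fst : ℝ) + ((ifsD IΔ Ia Ic Ie).fst : ℝ) ^ 2 ≤
        fsK Δ tpd tpp c ε := by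
      unfold fsK
      have h1 : ((ifsN Ia Ib Ic Ie).fst : ℝ) * ((icA IΔ Ie).fst : ℝ) ≤ fsN tpd tpp c ε * cA Δ ε :=
        mul_le_mul mN.1 mcA.1 hcA0' hN.le
      have h2 : ((ifsD IΔ Ia Ic Ie).fst : ℝ) ^ 2 ≤ fsD Δ tpd c ε ^ 2 := pow_le_pow_left₀ hDq'.le mD.1 2
      linarith
    linarith
  · push_cast; linarith

/-- Pointwise validity of the certified upper `s`-value: `x + y ≤ sigmaHi` at every zone contour point. [folklore] -/
theorem sum_le_sigmaHi {IΔ Ia Ib Ic Ie : NonemptyInterval ℚ} {Δ tpd tpp c x y ε : ℝ}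
    (mcA : cA Δ ε ∈ (icA IΔ Ie).ratCast ℝ) (mD : fsD Δ tpd c ε ∈ (ifsD IΔ Ia Ic Ie).ratCast ℝ)
    (mN : fsN tpd tpp c ε ∈ (ifsN Ia Ib Ic Ie).ratCast ℝ) (hN : 0 < fsN tpd tpp c ε) (hD : 0 < fsD Δ tpd c ε)
    (h4 : 0 < (iscale 4 (ifsD IΔ Ia Ic Ie)).fst)
    (h16 : 0 < (iscale 16 (ifsN Ia Ib Ic Ie) + iscale 4 (ifsD IΔ Ia Ic Ie)).fst)
    (hε : 0 ≤ ε) (hx : x ∈ Set.Icc (0 : ℝ) 1) (hy : y ∈ Set.Icc (0 : ℝ) 1)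
    (hP : charCubic Δ tpd tpp c x y ε = 0) :
    x + y ≤ ((sigmaHi IΔ Ia Ib Ic Ie : ℚ) : ℝ) := by
  unfold sigmaHi
  push_cast
  refine le_min ?_ ?_
  · have hA := sum_le_of_contour_face0 hN hD hx.1 hy.1 hP
    have m4D : 4 * fsD Δ tpd c ε ∈ (iscale 4 (ifsD IΔ Ia Ic Ie)).ratCast ℝ := by
      have := mem_iscale 4 mD; push_cast at this; exact this
    have mq := mem_idivPos h4 mcA m4D
    rw [mem_ratCast_iff] at mq
    exact hA.trans mq.2
  · have hB := sum_le_of_contour_face1 hN hD hε hx.1 hy.1 hx.2 hy.2 hP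
    have m4D : 4 * fsD Δ tpd c ε ∈ (iscale 4 (ifsD IΔ Ia Ic Ie)).ratCast ℝ := by
      have := mem_iscale 4 mD; push_cast at this; exact this
    have m16N : 16 * fsN tpd tpp c ε ∈ (iscale 16 (ifsN Ia Ib Ic Ie)).ratCast ℝ := by
      have := mem_iscale 16 mN; push_cast at this; exact this
    have mq := mem_idivPos h16 (mem_ratCast_sub mcA m4D) (mem_ratCast_add m16N m4D)
    rw [mem_ratCast_iff] at mq
    linarith [mq.2]

end Summit.Ventures.CertifiedManyBodySolver.Downfold.Emery
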